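import Summits.QuantumFields.BalabanUV.T4Continuum.Support.BalabanAveragedTowerApply
import Summits.QuantumFields.BalabanUV.T4Continuum.Support.BalabanMinimizerLaw
import Summits.QuantumFields.BalabanUV.T4Continuum.Spine.CovariantInjectedTower

/-!
# T⁴ programme, spine node NE2 (U1a) — THE `U = 1` LAYER OF NE2 FOR BAŁABAN's OWN AVERAGING, ASSEMBLED UNDER ONE NAME
# (`NE2UnitLayer.ne2UnitLayer : UnitLayer L M a`: sandwiched tower with rate + nondegenerate limit + semigroup identification + liaison instance +
# soft-minimiser tower; every `d`, every torus `M`, every `L ≥ 2`, `a > 0`), and the U ≠ 1 wall it leaves, by name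

Eighth generation of the NE2 prover lineage P1 of the cell `pub-balaban`, file 8 (assembly; no new estimate).  For the carver
and the consumers of node U1a: ONE structure `UnitLayer L M a` (namespace `NE2UnitLayer`) whose fields are exactly the `U = 1` statements proved in
files 2–7 of this generation for Bałaban's (1.11)/(1.18) averaging ([Balaban1984PropagatorsI] pp. 19–20) and the Landau-type
propagator `𝒢 = Δ_a^{−1}` (1.83) on the lattices `T_{L^{−k}}` over the torus of periods `M`:
 (1) `covTower` — the unit-lattice images `c_k = (L^d)^k·QBtow_k 𝒢^{(L^{−k})} QBtow_kᴴ` CONVERGE, `‖c_k − c_∞‖ ≤ CQB·L^{−k}/(1 − L^{−1})`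
     (`BalabanAveragedTowerUnit.unitCovB_tendsto`; the shape of [King1986] Lemma 4.5 (4.38));
 (2) `zeroModes` — `c_∞ J₀ = a⁻¹J₀` on `x`-constant fields ((1.82) along the tower) and `a⁻¹ ≤ ‖c_∞‖` for `d ≥ 1`
     (`BalabanAveragedTowerModes`);
 (3) `semigroup` — `QBtow_k` IS the single (1.18) operator, entrywise (`BalabanAveragedTowerApply.Atow_QBlev_apply`);
 (4) `liaison` — the entries form an instance of the cell's shape `T4EtaRateMin.LocalRate` (`localRate_unitCovB`);
 (5) `minimizerTower` — the soft minimiser maps `M̃_k = n_k^{d/2}·a·𝒢_kQBtow_kᴴ` ((1.71)/(1.74); King's `a_kG_kQ_k^*`) form a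
     Cauchy tower modulo King's isometric injections, `‖M̃_{k+n} − J_{k,n}M̃_k‖ ≤ a·CQH·L^{−k}/(1 − L^{−1})`
     (`BalabanMinimizerLaw.opNorm_Mtil_sub_Jtow_mul_le`; the shape of [King1986] Prop. 3.8 (3.71)); the underlying one-step
     statement is the Spine's `CovariantInjectedTower.OneStepInjectedLaw` instantiated (`oneStepInjectedLaw_Mtil`).
 **`ne2UnitLayer`**: the structure is INHABITED (a theorem, no hypothesis beyond `2 ≤ L`, `0 < a`, `1 ≤ d`).  Corollary: the SOFT
 EFFECTIVE UNIT-LATTICE OPERATORS `E_k = a − a²c_k` (King's (2.14) form, the lineage's `B5QGQ171Unit.effOp` along the tower) CONVERGE,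
 rate `a²·CQB·L^{−k}/(1 − L^{−1})`, with the constants as zero modes of the limit (`effOpB_tendsto`).

WHAT IT IS NOT (the wall, by name).  NE2 proper is the same family of statements at a BACKGROUND `U ≠ 1` for the covariant
averaging `Q(U)` and the propagators `G_k(U)`, `H_k(U)`, `C^{(k)}(U)` of [Balaban1985BackgroundPropagators]; there the one-step
law is the cell's open row G-an2-4, typed as the hypothesis shape `CovariantAveragingTower.OneStepAveragedLaw` and reduced to
the tower conclusion by `CovariantAveragingTower.towerLimitRate_of_oneStepAveragedLaw` — NOT discharged here or anywhere in the
tree.  Also NOT here: position-space decay of the kernels (lineage P2's currency), the constrained objects `(QGQ*)^{−1}`, `H_k`,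
`Δ_k` (inversion; G-an2-4's K-slot), constants evaluated at `d = 4`, any identification of `c_∞` with a continuum object.

HONEST FRAMING (T4-DAG p. 1).  Rung (B)+1 on a FIXED FINITE torus, linear layer, `U = 1`, operator norm; statements and
constants OURS ([folklore]); NOT infinite volume, NOT a mass gap, NOT Clay, NOT summit progress; spine estimates proved: 0/9
(NE2 at `U ≠ 1` is one of them and stays WALLED).  HONEST DEPENDENCY: continuum YM on T⁴ ⇐ BetaPertH ∧ nine spine estimates
(0/9 proved); BetaPertH ⇐ (D1) ∧ (D4) ∧ CAP+tail; G-an2-4 gates asym, D1 and NE2/3/4.  ABSOLUTE RULE kept; no `sorry`.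
-/

noncomputable section

open scoped BigOperators ComplexConjugate Matrix Matrix.Norms.L2Operator
open Filter Topology

namespace Summit.QuantumFields.BalabanUV.T4Continuum.NE2UnitLayer

open Literature.MathematicalPhysics.QuantumFieldTheory.Balaban1983to89.B5Prop11Plancherel
open Literature.MathematicalPhysics.QuantumFieldTheory.Balaban1983to89.B5G183RateUnitTower (lev lev_neZero)
open Literature.MathematicalPhysics.QuantumFieldTheory.Balaban1983to89.T4EtaRateMin (LocalRate)
open Summit.QuantumFields.BalabanUV.T4Continuum.CovariantAveragingTower
open Summit.QuantumFields.BalabanUV.T4Continuum.CovariantInjectedTower (OneStepInjectedLaw)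
open Summit.QuantumFields.BalabanUV.T4Continuum.BalabanLineAverage
open Summit.QuantumFields.BalabanUV.T4Continuum.BalabanAveragedTowerUnit
open Summit.QuantumFields.BalabanUV.T4Continuum.BalabanAveragedTowerModes
open Summit.QuantumFields.BalabanUV.T4Continuum.BalabanAveragedTowerApply
open Summit.QuantumFields.BalabanUV.T4Continuum.BalabanBlockPoincare
open Summit.QuantumFields.BalabanUV.T4Continuum.BalabanMinimizerLaw

variable {d : ℕ} (L : ℕ) [NeZero L] (M : Fin d → ℕ) [hM : ∀ μ, NeZero (M μ)] (a : ℝ) (ha : 0 < a)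

/-- **THE `U = 1` LAYER OF NE2 FOR BAŁABAN's AVERAGING** as one structure (fields documented in the module docstring; every
field is a statement proved in files 2–7 of the generation, none is a hypothesis). [folklore] -/
structure UnitLayer : Prop where
  /-- (1) the (1.18)-averaged unit-lattice free covariance converges, rate `CQB·L^{−k}/(1 − L^{−1})`, and the limit has the zero
  modes `c_∞ J₀ = a⁻¹J₀` with `a⁻¹ ≤ ‖c_∞‖`. -/
  covTower : ∃ cinf : Matrix (idx L M 0) (idx L M 0) ℂ,
    Tendsto (unitCovB L M a ha) atTop (𝓝 cinf) ∧
    (∀ k, ‖unitCovB L M a ha k - cinf‖ ≤ CQB d a * ((L : ℝ)⁻¹) ^ k / (1 - (L : ℝ)⁻¹)) ∧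
    (∀ c : Fin d → ℂ, cinf *ᵥ cst L M 0 c = ((a : ℂ))⁻¹ • cst L M 0 c) ∧ a⁻¹ ≤ ‖cinf‖
  /-- (2) uniform bounds along the tower: `a⁻¹ ≤ ‖c_k‖ ≤ Cst`. -/
  covBounds : ∀ k, a⁻¹ ≤ ‖unitCovB L M a ha k‖ ∧ ‖unitCovB L M a ha k‖ ≤ Cst d a
  /-- (3) the composite averaging IS (1.18), entrywise. -/
  semigroup : ∀ (k : ℕ) (i : idx L M 0) (y : idx L M k), Atow (QBlev L M) k i y
    = if i.2 = y.2 then ((((lev L k : ℕ) : ℂ)) ^ (d + 1))⁻¹ * lineCount M (lev L k) (fun ν => (i.1 ν).val) i.2 y.1 else 0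
  /-- (4) the liaison currency: an instance of `T4EtaRateMin.LocalRate`. -/
  liaison : LocalRate (covBReadings L M a ha) (CQB d a) ((L : ℝ)⁻¹)
  /-- (5) the soft minimiser maps form a Cauchy tower modulo King's injections. -/
  minimizerTower : ∀ k n, ‖Mtil L M a ha (k + n) - Jtow L M k n * Mtil L M a ha k‖
    ≤ a * CQH d a * ((L : ℝ)⁻¹) ^ k / (1 - (L : ℝ)⁻¹)

/-- **`ne2UnitLayer`**: the `U = 1` layer of NE2 for Bałaban's averaging HOLDS (`L ≥ 2`, `a > 0`, `d ≥ 1`; every torus `M`).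
[cite: Balaban1984PropagatorsI, (1.18) p.20, (1.82) p.31, Prop. 1.1 (1.89) p.33; King1986, Prop. 3.8 (3.71) p.664, Lemma 4.5
(4.38) p.674 (shapes)] [folklore] -/
theorem ne2UnitLayer (hL : 2 ≤ L) (hd : 0 < d) : UnitLayer L M a ha := by
  obtain ⟨cinf, hlim, hrate⟩ := unitCovB_tendsto L M a ha hL
  refine ⟨⟨cinf, hlim, hrate, fun c => limit_mulVec_cst L M a ha hlim c, inv_le_opNorm_limit L M a ha hd hlim⟩,
    fun k => ⟨inv_le_opNorm_unitCovB L M a ha hd k, opNorm_unitCovB_le L M a ha k⟩,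
    fun k i y => Atow_QBlev_apply L M k i y, localRate_unitCovB L M a ha,
    fun k n => opNorm_Mtil_sub_Jtow_mul_le L M a ha hL k n⟩

/-- the Spine's INJECTED hypothesis shape HOLDS at `U = 1` for (King's pairing `Jpc`, the soft minimiser maps `Mtil`) with
`e_k = a·CQH·L^{−k}` — the instance behind field (5); at `U ≠ 1` the same shape for `(H_k(U), covariant injections)` is the
un-sandwiched half of row G-an2-4. [folklore] -/
theorem oneStepInjectedLaw_Mtil :
    OneStepInjectedLaw (ι := idx L M) (Jpc L M) (Mtil L M a ha) (fun k => a * CQH d a * ((L : ℝ)⁻¹) ^ k) :=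
  fun k => opNorm_Mtil_succ_sub_le L M a ha k

/-- the U ≠ 1 WALL, by name: what NE2 proper needs and does not have — an instance of `OneStepAveragedLaw` for covariant
averagings and background propagators; GIVEN one (with `‖A k‖² ≤ r⁻¹`, geometric errors), the tower conclusion follows by the
Spine reduction.  This is a restatement of `CovariantAveragingTower.towerLimitRate_of_oneStepAveragedLaw` for the record;
nothing is discharged. [folklore] -/
theorem ne2Plus_of_oneStepAveragedLaw {ι : ℕ → Type*} [∀ k, Fintype (ι k)] [∀ k, DecidableEq (ι k)]
    (A : (k : ℕ) → Matrix (ι k) (ι (k + 1)) ℂ) {r : ℝ} (hr : 0 < r) (hA : ∀ k, ‖A k‖ ^ 2 ≤ r⁻¹)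
    (X : (k : ℕ) → Matrix (ι k) (ι k) ℂ) {C ρ : ℝ} (hρ1 : ρ < 1)
    (wall : OneStepAveragedLaw A r X (fun k => C * ρ ^ k)) : TowerLimitRate A r X C ρ :=
  towerLimitRate_of_oneStepAveragedLaw A hr hA X hρ1 wall

/-! ## The soft effective unit-lattice operator `a − a²·c_k` (King's (2.14) form for Bałaban's averaging) converges -/

/-- the SOFT EFFECTIVE UNIT-LATTICE OPERATOR after `k` steps: `E_k = a·1 − a²·c_k` — the quadratic form in `B` produced by the
Gaussian `A`-integration of `exp[−½⟨A, Δ_a A⟩ + a⟨Q_kA, B⟩ − ½a‖B‖²]` (complete the square: [King1986] (2.13)→(2.14), whose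
effective operator is «a_k(L^kε)^{−2}I − a_k²(L^kε)^{−4}Q_k(A)G^ε_k(Ω,A)Q_k(A)^*. (2.14)» — here at `A = 0` with the units
`(L^kε)` suppressed, `a − a²QGQ^*`; for Bałaban's `Δ_a` and averaging (1.18) at ONE level this is the lineage's `B5QGQ171Unit.effOp`,
here along the tower on the unit lattice `Tor (fine 1 M)`; v1.0.1: the (2.14) string is now quoted verbatim). [cite: King1986, (2.13)-(2.14) p.653; Balaban1984PropagatorsI, (1.68)-(1.69)
p.29] [folklore] -/
def effOpB (k : ℕ) : Matrix (idx L M 0) (idx L M 0) ℂ :=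
  ((a : ℂ)) • (1 : Matrix (idx L M 0) (idx L M 0) ℂ) - ((a : ℂ) ^ 2) • unitCovB L M a ha k

/-- **the soft effective operators converge** (`L ≥ 2`): `‖E_k − E_∞‖ ≤ a²·CQB·L^{−k}/(1 − L^{−1})` with `E_∞ = a − a²c_∞`, and
the constants are ZERO MODES of the limit: `E_∞ J₀ = (a − a²·a⁻¹)J₀ = 0` ((1.82)). [cite: King1986, (2.14) p.653, Lemma 4.3 (4.18)
p.672 (scalar rate template); Balaban1984PropagatorsI, (1.82) p.31] — statements ours. [folklore] -/
theorem effOpB_tendsto (hL : 2 ≤ L) :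
    ∃ Einf : Matrix (idx L M 0) (idx L M 0) ℂ,
      Tendsto (effOpB L M a ha) atTop (𝓝 Einf) ∧
      (∀ k, ‖effOpB L M a ha k - Einf‖ ≤ a ^ 2 * (CQB d a * ((L : ℝ)⁻¹) ^ k / (1 - (L : ℝ)⁻¹))) ∧
      ∀ c : Fin d → ℂ, Einf *ᵥ cst L M 0 c = 0 := by
  obtain ⟨cinf, hlim, hrate⟩ := unitCovB_tendsto L M a ha hL
  have ha0 : (a : ℂ) ≠ 0 := by exact_mod_cast ha.ne'
  refine ⟨((a : ℂ)) • 1 - ((a : ℂ) ^ 2) • cinf, ?_, fun k => ?_, fun c => ?_⟩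
  · exact (tendsto_const_nhds.sub (hlim.const_smul ((a : ℂ) ^ 2)))
  · have e : effOpB L M a ha k - (((a : ℂ)) • 1 - ((a : ℂ) ^ 2) • cinf) = -(((a : ℂ) ^ 2) • (unitCovB L M a ha k - cinf)) := by
      rw [effOpB, smul_sub]; abel
    rw [e, norm_neg, norm_smul, norm_pow, Complex.norm_real, Real.norm_of_nonneg ha.le]
    exact mul_le_mul_of_nonneg_left (hrate k) (pow_nonneg ha.le 2)
  · rw [Matrix.sub_mulVec, Matrix.smul_mulVec, Matrix.one_mulVec, Matrix.smul_mulVec, limit_mulVec_cst L M a ha hlim c,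
      smul_smul, pow_two, mul_assoc, mul_inv_cancel₀ ha0, mul_one, sub_self]

end Summit.QuantumFields.BalabanUV.T4Continuum.NE2UnitLayer

end
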